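import Summits.HodgeConjecture.CorCM.MultiFieldWeilUnitsDefectLaw
import Summits.HodgeConjecture.CorCM.MultiFieldWeilTwinsRealised
import HarnessLib

/-!
# MULTI-FIELD WEIL ENGINE — UNITS OF ANY SIZE, REALISED: the defect law for realised tuples whose slots are grouped into units (several CM types of ONE field, read in
# one frame), and the frame-form headline given the single-slot Weil spaces

Cell `pub-hodgecm2` (COR-CM), seat b30 gen 39 (2026-08-25); own lane MULTI-FIELD WEIL ENGINE (stem `MultiFieldWeil*`), the realised reading of
`CorCM/MultiFieldWeilUnitsDefectLaw.lean` (U2) — gen 38's `CorCM/MultiFieldWeilTwinsKindRealised.lean` (T2c) with the twin pairs of an involution (singleton position sets)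
replaced by UNITS OF ANY SIZE WITH ARBITRARY POSITION SETS whose centred indicators are linearly independent.  Theorems only; no definition, no named fact, no `sorry`.
HONEST FRAMING: the headline is conditional on the displayed single-slot Weil spaces `hW m`; `HC_CM` is NOT proved and not asserted.  Consumer: the menu with SEVERAL
ISOGENY CLASSES PER FIELD (sequel).

[cite: MoonenZarhin1995Duke, Thm. 2.4] [cite: Pohlmann1968, Thm 1] [cite: Milne2020HodgeClassesAV, 1.2 (a) and Thm. 1] [cite: Shimura1998, §18.2 Lemma (i)]
[cite: DixonMortimer1996, §1.4 Ex. 1.4.1–1.4.2; §1.6 and Thm. 1.6A; §2.1] [cite: Lang2002, XIII §4] [cite: MumfordAV1970, §19 Thm. 1 and p. 169]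

## References
* [MoonenZarhin1995Duke] B. Moonen, Yu. Zarhin, Duke Math. J. 77 (1995), Thm. 2.4.  [Pohlmann1968] H. Pohlmann, Ann. of Math. 88 (1968), Thm 1.  [Milne2020HodgeClassesAV] J. S. Milne,
  Hodge classes on abelian varieties (2020), §1.  [Shimura1998] G. Shimura, *Abelian varieties with CM and modular functions*, §18.2.  [DixonMortimer1996] J. D. Dixon,
  B. Mortimer, *Permutation Groups*, GTM 163, §1.4, §1.6, §2.1.  [Lang2002] S. Lang, *Algebra*, GTM 211, XIII §4.  [MumfordAV1970] D. Mumford, *Abelian Varieties*, §19.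
-/

noncomputable section

open CategoryTheory CategoryTheory.Limits NumberField IntermediateField

namespace Summit.HodgeConjecture.CorCM.MultiFieldWeil

open Finset
open Literature.AlgebraicGeometry Literature.AlgebraicGeometry.Motives Literature.AlgebraicGeometry.HodgeTheory
open Literature.AlgebraicGeometry.ComplexMultiplication (IsCMTypeRealisation)
open Literature.AlgebraicTopology.SingularHomology
open Literature.NumberTheory.ComplexMultiplication
open Summit.HodgeConjecture.CorCM.Census.MultiFieldWeil

open scoped Classical

/-! ## §1 The defect law for realised tuples with units of any size -/

section Realised

variable {I : Type} {r : ℕ} {Kf : I → Type} [∀ i, Field (Kf i)] [∀ i, NumberField (Kf i)] {i₀ : I} {is : Fin r → I} {n : Fin r → ℕ}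
  {e : ∀ m : Fin r, (Kf (is m) →+* ℂ) ≃ Fin (n m) × Bool} {τ : Kf i₀ →+* ℂ} {im : ∀ m : Fin r, Kf i₀ →+* Kf (is m)}
  (he_sign : ∀ (m : Fin r) (s : Kf (is m) →+* ℂ), (e m s).2 = true ↔ s.comp (im m) = τ)

include he_sign in
/-- **THE DEFECT LAW FOR REALISED TUPLES WITH UNITS OF ANY SIZE, SLOT MENU ON THE SINGLE SLOTS** (`CorCM/MultiFieldWeilUnitsDefectLaw` for the realised tuples: units = the
fibres of `U`, one size and diagonal realised tuples inside a unit, `2`-transitive on every unit with at least two slots, the centred indicators of the position sets of a unit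
linearly independent; single slots prime ∕ one-member ∕ homogeneous; realised tuples trivial on a unit transitive on every slot outside it). [cite: MoonenZarhin1995Duke, Thm. 2.4]
[cite: Shimura1998, §18.2 Lemma (i)] [cite: DixonMortimer1996, §1.4 Ex. 1.4.1–1.4.2; §1.6 and Thm. 1.6A; §2.1] [cite: Lang2002, XIII §4] -/
theorem exists_hasDefectsG_realisedTuples_of_units
    (U : Fin r → Fin r) (hn : ∀ m m' : Fin r, U m' = U m → n m' = n m)
    (hdiag : ∀ π ∈ realisedTuples e τ, ∀ (m m' : Fin r) (h : U m' = U m) (a : Fin (n m')), Fin.cast (hn m m' h) (π m' a) = π m (Fin.cast (hn m m' h) a))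
    (h2t : ∀ m, (∃ m', m' ≠ m ∧ U m' = U m) → ∀ a a' b b' : Fin (n m), a ≠ a' → b ≠ b' → ∃ π ∈ realisedTuples e τ, π m a = b ∧ π m a' = b')
    (hstab : ∀ (m₀ m : Fin r), U m₀ ≠ U m → ∀ a a' : Fin (n m), ∃ ν ∈ realisedTuples e τ, (∀ m', U m' = U m₀ → ν m' = 1) ∧ ν m a = a')
    {P : ∀ m : Fin r, Finset (Fin (n m))}
    (hkind : ∀ m, (∀ m', U m' = U m → m' = m) → ((n m).Prime ∧ (P m).Nonempty ∧ (P m).card < n m) ∨ (P m).card = 1 ∨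
      ((0 < (P m).card ∧ (P m).card < n m) ∧ ∀ Q : Finset (Fin (n m)), Q.card = (P m).card → ∃ π ∈ realisedTuples e τ, preG (π m) (P m) = Q))
    (hli : ∀ m, (∃ m', m' ≠ m ∧ U m' = U m) → LinearIndependent ℚ fun m' : {m' : Fin r // U m' = U m} => fun q : Fin (n m) =>
      ((n m : ℚ) * (if q ∈ (P m'.1).image (Fin.cast (hn m m'.1 m'.2)) then 1 else 0) - (P m'.1).card))
    (c : Fin r → ℕ) (hc : ∀ m, ((c m : ℕ) : ℤ) = (n m : ℤ) - 2 * (P m).card)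
    {α : Type} (v : α → PtG n) (T : Finset α) (hT : ModelBalancedG P (realisedTuples e τ) v T) : ∃ t : Fin r → ℤ, HasDefectsG c v T t :=
  exists_hasDefectsG_of_unitsStabiliserTransitive (fun _ hπ _ hπ' => mul_mem_realisedTuples e τ hπ hπ') (fun _ hπ => inv_mem_realisedTuples hπ)
    (realisedTuples_nonempty (e := e) he_sign) (fun m a b => transitive_realisedTuples (e := e) he_sign m a b) U hn hdiag h2t hstab hkind hli c hc v T hT

end Realised

/-! ## §2 The headline, frame form -/

section Headline

variable {I : Type} {r : ℕ} {Kf : I → Type} [∀ i, Field (Kf i)] [∀ i, NumberField (Kf i)] [∀ i, IsCMField (Kf i)]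
  {i₀ : I} {is : Fin r → I} {n : Fin r → ℕ} {τ : Kf i₀ →+* ℂ}
  {A : Fin (r + 1) → AbelianVariety ℂ} {Φ : ∀ j : Fin (r + 1), CMType (Kf (mfSlots i₀ is j))}
  {ι : ∀ j, 𝓞 (Kf (mfSlots i₀ is j)) →+* End (A j)}
  {θ : ∀ j, Kf (mfSlots i₀ is j) →+* Module.End ℂ (complexBetti (A j).X 1)}

/-- **HEADLINE (frame form) — UNITS OF ANY SIZE WITH THE SLOT MENU ON THE SINGLE SLOTS, GIVEN THE SINGLE-SLOT WEIL SPACES.**  As T2c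
`hodgeConjectureFor_biproduct_comp_of_twins_kind_frames` with the twin pairs replaced by units: `k = Kf i₀` imaginary quadratic, `E = A 0 ⊨ (k; {τ})` (`τ(δ) = i√d`),
`B_m = A (m+1) ⊨ (K_m; Φ (m+1))` over CM fields `K_m ⊇ i_m(k)`, `[K_m : k] = n_m`, types read by frames `e m` at position sets `P m` of sizes `p_m` (`0 < p_m`, `2 p_m ≤ n_m`);
UNITS = the fibres of `U : Fin r → Fin r` (one size, realised tuples diagonal, `2`-transitive on units with two or more slots, the centred indicators `n·𝟙_{P m'} − p_{m'}·𝟙` of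
a unit linearly independent over `ℚ`); the realised tuples trivial on a unit transitive on every slot outside it; single slots prime ∕ `p_m = 1` ∕ homogeneous.  Then the
Hodge conjecture holds for EVERY product of copies `⨁_j A(κ j)` GIVEN the single-slot Weil spaces `hW m`.  `HC_CM` is NOT asserted. [cite: Pohlmann1968, Thm 1]
[cite: MoonenZarhin1995Duke, Thm. 2.4] [cite: Milne2020HodgeClassesAV, 1.2 (a) and Thm. 1] [cite: DixonMortimer1996, §1.4 Ex. 1.4.1–1.4.2; §1.6 and Thm. 1.6A; §2.1]
[cite: Lang2002, XIII §4] -/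
theorem hodgeConjectureFor_biproduct_comp_of_units_frames (P : ∀ m : Fin r, Finset (Fin (n m))) (p : Fin r → ℕ)
    (hcard : ∀ m, (P m).card = p m) (hp0 : ∀ m, 0 < p m) (hpn : ∀ m, 2 * p m ≤ n m)
    {N : ℕ} (κ : Fin N → Fin (r + 1)) (h2 : Module.finrank ℚ (Kf i₀) = 2) (im : ∀ m : Fin r, Kf i₀ →+* Kf (is m))
    {δ : 𝓞 (Kf i₀)} {d : ℕ} (hτ : τ (δ : Kf i₀) = Complex.I * (Real.sqrt d : ℂ))
    (hA : ∀ j, IsCMTypeRealisation (Φ j) (A j) (ι j) (θ j))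
    (e : ∀ m : Fin r, (Kf (is m) →+* ℂ) ≃ Fin (n m) × Bool)
    (he_sign : ∀ (m : Fin r) (s : Kf (is m) →+* ℂ), (e m s).2 = true ↔ s.comp (im m) = τ)
    (he_conj : ∀ (m : Fin r) (s : Kf (is m) →+* ℂ), e m (ComplexEmbedding.conjugate s) = ((e m s).1, !(e m s).2))
    (hΨ : ∀ σ : Kf i₀ →+* ℂ, σ ∈ (Φ 0).1 ↔ σ = τ)
    (hΦ : ∀ (m : Fin r) (s : Kf (is m) →+* ℂ), s ∈ (Φ m.succ).1 ↔ (e m s).2 = decide ((e m s).1 ∈ P m))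
    (U : Fin r → Fin r) (hn : ∀ m m' : Fin r, U m' = U m → n m' = n m)
    (hdiag : ∀ π ∈ realisedTuples e τ, ∀ (m m' : Fin r) (h : U m' = U m) (a : Fin (n m')), Fin.cast (hn m m' h) (π m' a) = π m (Fin.cast (hn m m' h) a))
    (h2t : ∀ m, (∃ m', m' ≠ m ∧ U m' = U m) → ∀ a a' b b' : Fin (n m), a ≠ a' → b ≠ b' → ∃ π ∈ realisedTuples e τ, π m a = b ∧ π m a' = b')
    (hstab : ∀ (m₀ m : Fin r), U m₀ ≠ U m → ∀ a a' : Fin (n m), ∃ ν ∈ realisedTuples e τ, (∀ m', U m' = U m₀ → ν m' = 1) ∧ ν m a = a')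
    (hli : ∀ m, (∃ m', m' ≠ m ∧ U m' = U m) → LinearIndependent ℚ fun m' : {m' : Fin r // U m' = U m} => fun q : Fin (n m) =>
      ((n m : ℚ) * (if q ∈ (P m'.1).image (Fin.cast (hn m m'.1 m'.2)) then 1 else 0) - (P m'.1).card))
    (hkind : ∀ m : Fin r, (∀ m', U m' = U m → m' = m) → (n m).Prime ∨ p m = 1 ∨
      ∀ Q : Finset (Fin (n m)), Q.card = p m → ∃ π ∈ realisedTuples e τ, preG (π m) (P m) = Q)
    (hW : ∀ m : Fin r, weilClassesOf (⨁ fun i => A (partSlots (n m - 2 * p m) m i))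
      (biproduct.map fun i => ι (partSlots (n m - 2 * p m) m i) (δfam im δ (partSlots (n m - 2 * p m) m i))) (n m - p m) d ≤
      algebraicClasses (⨁ fun i => A (partSlots (n m - 2 * p m) m i)).X (n m - p m)) :
    HodgeConjectureFor (⨁ fun j => A (κ j)).dim (⨁ fun j => A (κ j)).X :=
  hodgeConjectureFor_biproduct_comp_of_defectLawG (is := is) P (fun m => n m - 2 * p m) (fun m => n m - p m)
    (fun m => by have := hpn m; omega) (fun m => by have := hp0 m; have := hpn m; omega) κ h2 im hτ hA e he_sign he_conj hΨ hΦ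
    (fun v T hT => exists_hasDefectsG_realisedTuples_of_units (e := e) he_sign U hn hdiag h2t hstab
      (fun m hsingle => by
        rcases hkind m hsingle with hpr | h1 | hhom
        · exact Or.inl ⟨hpr, Finset.card_pos.1 (by rw [hcard m]; exact hp0 m), by have := hpn m; have := hp0 m; rw [hcard m]; omega⟩
        · exact Or.inr (Or.inl (by rw [hcard m, h1]))
        · exact Or.inr (Or.inr ⟨⟨by rw [hcard m]; exact hp0 m, by have := hpn m; have := hp0 m; rw [hcard m]; omega⟩,
            fun Q hQ => hhom Q (by rw [hQ, hcard m])⟩))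
      hli (fun m => n m - 2 * p m) (cast_sub_two_mul_eq hcard hpn) v T hT) hW

/-- **Dominated form.** [cite: MumfordAV1970, §19 Thm. 1 and p. 169] [cite: Pohlmann1968, Thm 1] -/
theorem hodgeConjectureFor_of_avDominatedBy_comp_of_units_frames (P : ∀ m : Fin r, Finset (Fin (n m))) (p : Fin r → ℕ)
    (hcard : ∀ m, (P m).card = p m) (hp0 : ∀ m, 0 < p m) (hpn : ∀ m, 2 * p m ≤ n m)
    {N : ℕ} (κ : Fin N → Fin (r + 1)) (h2 : Module.finrank ℚ (Kf i₀) = 2) (im : ∀ m : Fin r, Kf i₀ →+* Kf (is m))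
    {δ : 𝓞 (Kf i₀)} {d : ℕ} (hτ : τ (δ : Kf i₀) = Complex.I * (Real.sqrt d : ℂ))
    (hA : ∀ j, IsCMTypeRealisation (Φ j) (A j) (ι j) (θ j))
    (e : ∀ m : Fin r, (Kf (is m) →+* ℂ) ≃ Fin (n m) × Bool)
    (he_sign : ∀ (m : Fin r) (s : Kf (is m) →+* ℂ), (e m s).2 = true ↔ s.comp (im m) = τ)
    (he_conj : ∀ (m : Fin r) (s : Kf (is m) →+* ℂ), e m (ComplexEmbedding.conjugate s) = ((e m s).1, !(e m s).2))
    (hΨ : ∀ σ : Kf i₀ →+* ℂ, σ ∈ (Φ 0).1 ↔ σ = τ)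
    (hΦ : ∀ (m : Fin r) (s : Kf (is m) →+* ℂ), s ∈ (Φ m.succ).1 ↔ (e m s).2 = decide ((e m s).1 ∈ P m))
    (U : Fin r → Fin r) (hn : ∀ m m' : Fin r, U m' = U m → n m' = n m)
    (hdiag : ∀ π ∈ realisedTuples e τ, ∀ (m m' : Fin r) (h : U m' = U m) (a : Fin (n m')), Fin.cast (hn m m' h) (π m' a) = π m (Fin.cast (hn m m' h) a))
    (h2t : ∀ m, (∃ m', m' ≠ m ∧ U m' = U m) → ∀ a a' b b' : Fin (n m), a ≠ a' → b ≠ b' → ∃ π ∈ realisedTuples e τ, π m a = b ∧ π m a' = b')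
    (hstab : ∀ (m₀ m : Fin r), U m₀ ≠ U m → ∀ a a' : Fin (n m), ∃ ν ∈ realisedTuples e τ, (∀ m', U m' = U m₀ → ν m' = 1) ∧ ν m a = a')
    (hli : ∀ m, (∃ m', m' ≠ m ∧ U m' = U m) → LinearIndependent ℚ fun m' : {m' : Fin r // U m' = U m} => fun q : Fin (n m) =>
      ((n m : ℚ) * (if q ∈ (P m'.1).image (Fin.cast (hn m m'.1 m'.2)) then 1 else 0) - (P m'.1).card))
    (hkind : ∀ m : Fin r, (∀ m', U m' = U m → m' = m) → (n m).Prime ∨ p m = 1 ∨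
      ∀ Q : Finset (Fin (n m)), Q.card = p m → ∃ π ∈ realisedTuples e τ, preG (π m) (P m) = Q)
    (hW : ∀ m : Fin r, weilClassesOf (⨁ fun i => A (partSlots (n m - 2 * p m) m i))
      (biproduct.map fun i => ι (partSlots (n m - 2 * p m) m i) (δfam im δ (partSlots (n m - 2 * p m) m i))) (n m - p m) d ≤
      algebraicClasses (⨁ fun i => A (partSlots (n m - 2 * p m) m i)).X (n m - p m))
    {X : AbelianVariety ℂ} (hX : Domination.AVDominatedBy X (⨁ fun j => A (κ j))) : HodgeConjectureFor X.dim X.X :=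
  Domination.hodgeConjectureFor_of_avDominatedBy
    (hodgeConjectureFor_biproduct_comp_of_units_frames P p hcard hp0 hpn κ h2 im hτ hA e he_sign he_conj hΨ hΦ U hn hdiag h2t hstab hli hkind hW) hX

end Headline

end Summit.HodgeConjecture.CorCM.MultiFieldWeil

end
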